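import Mathlib
import HarnessLib
import Literature.Dynamics.Hyperbolic.RGFlowStableManifoldSecondDiff

/-!
# The fine-tuning theorem with norm-bound predicates, V: the perturbation sizes are (bi)linear in the
# parameter increments ([ABKM19] Lemma 12.6, bookkeeping)

When the four systems of `RGFlowStableManifoldSecondDiff` sit at the corners `p, p + sU, p + tV,
p + sU + tV` of a parameter parallelogram and the data depend on the parameter with Lipschitz constants
`a₀, b₀, l₀, m₀`, difference-Lipschitz constant `l₀'` and second-difference constants
`a₀₀, b₀₀, l₀₀, m₀₀`, the first-order sizes are `a₀s, b₀s, …`, the first differences of the trajectories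
are `D₁ = K₁ s`, `D₂ = K₂ t`, and the second-order sizes are `a₀₀st, …`.  Then

* `RGFlow.pertSize_linear` — `pertSize α β η ε (a₀t) (b₀t) (l₀t) (m₀t) = t · max m₀ (max (l₀ε/η) ((αb₀ + a₀(η+β+b₀t))ε))`;
* `RGFlow.secondPertSize_bilinear` — `secondPertSize … = s·t·(explicit constant)`,

so that `secondDiff_le_of_isTunedQ` yields second differences `≤ C·s·t`, the input of
`norm_secondDiff_fixedPoint_le` (difference-form `C^{1,1}` dependence of the second fixed point).
Everything is proved; no named fact.

## References
* S. Adams, S. Buchholz, R. Kotecký, S. Müller, arXiv:1910.13564, Lemma 12.6, (12.51)–(12.56)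
  [AdamsBuchholzKoteckyMuller2019].
-/

noncomputable section

namespace Literature.Dynamics.Hyperbolic

namespace RGFlow

/-- **The first-order size is linear in the parameter increment**:
`pertSize α β η ε (a₀t) (b₀t) (l₀t) (m₀t) = t · max m₀ (max (l₀ε/η) ((αb₀ + a₀(η+β+b₀t))ε))` for `t ≥ 0`.
[cite: AdamsBuchholzKoteckyMuller2019, Lemma 12.6 (12.51)–(12.53)] -/
theorem pertSize_linear {α β η ε a₀ b₀ l₀ m₀ t : ℝ} (ht : 0 ≤ t) :
    pertSize α β η ε (a₀ * t) (b₀ * t) (l₀ * t) (m₀ * t)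
      = t * max m₀ (max (l₀ * ε / η) ((α * b₀ + a₀ * (η + β + b₀ * t)) * ε)) := by
  unfold pertSize
  have e1 : m₀ * t = t * m₀ := mul_comm _ _
  have e2 : l₀ * t * ε / η = t * (l₀ * ε / η) := by ring
  have e3 : (α * (b₀ * t) + a₀ * t * (η + β + b₀ * t)) * ε = t * ((α * b₀ + a₀ * (η + β + b₀ * t)) * ε) := by
    ring
  rw [e1, e2, e3, ← mul_max_of_nonneg _ _ ht, ← mul_max_of_nonneg _ _ ht]

/-- **The second-order size is bilinear in the two parameter increments**: with first-order sizes
`a₀s, b₀s, l₀'s` / `a₀t, b₀t, l₀'t`, trajectory differences `K₁s`, `K₂t` and second-order sizes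
`a₀₀st, b₀₀st, l₀₀st, m₀₀st` (`s, t ≥ 0`),
`secondPertSize … = s·t·max m₀₀ (max ((σ₂K₁K₂ + l₀'(K₂ + K₁) + l₀₀ε)/η)
  (α(b₀(K₂+K₁) + b₀₀ε) + (η+β)(a₀(K₂+K₁) + a₀₀ε) + 2a₀b₀ε))`.
[cite: AdamsBuchholzKoteckyMuller2019, Lemma 12.6 (12.51)–(12.56)] -/
theorem secondPertSize_bilinear {α β η ε σ₂ a₀ b₀ l₀' a₀₀ b₀₀ l₀₀ m₀₀ K₁ K₂ s t : ℝ}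
    (hs : 0 ≤ s) (ht : 0 ≤ t) :
    secondPertSize α β η ε σ₂ (a₀ * s) (a₀ * t) (a₀₀ * s * t) (b₀ * s) (b₀ * t) (b₀₀ * s * t)
        (l₀' * s) (l₀' * t) (l₀₀ * s * t) (m₀₀ * s * t) (K₁ * s) (K₂ * t)
      = s * t * max m₀₀ (max ((σ₂ * K₁ * K₂ + l₀' * (K₂ + K₁) + l₀₀ * ε) / η)
          (α * (b₀ * (K₂ + K₁) + b₀₀ * ε) + (η + β) * (a₀ * (K₂ + K₁) + a₀₀ * ε) + 2 * a₀ * b₀ * ε)) := by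
  unfold secondPertSize
  have hst : 0 ≤ s * t := mul_nonneg hs ht
  have e1 : m₀₀ * s * t = s * t * m₀₀ := by ring
  have e2 : (σ₂ * (K₁ * s) * (K₂ * t) + l₀' * s * (K₂ * t) + l₀' * t * (K₁ * s) + l₀₀ * s * t * ε) / η
      = s * t * ((σ₂ * K₁ * K₂ + l₀' * (K₂ + K₁) + l₀₀ * ε) / η) := by ring
  have e3 : α * (b₀ * s * (K₂ * t) + b₀ * t * (K₁ * s) + b₀₀ * s * t * ε)
        + (η + β) * (a₀ * s * (K₂ * t) + a₀ * t * (K₁ * s) + a₀₀ * s * t * ε)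
        + (a₀ * s * (b₀ * t) + a₀ * t * (b₀ * s)) * ε
      = s * t * (α * (b₀ * (K₂ + K₁) + b₀₀ * ε) + (η + β) * (a₀ * (K₂ + K₁) + a₀₀ * ε) + 2 * a₀ * b₀ * ε) := by
    ring
  rw [e1, e2, e3, ← mul_max_of_nonneg _ _ hst, ← mul_max_of_nonneg _ _ hst]

/-- **The second-order size of the four-fixed-point theorem is bilinear in the two perturbation
increments** (the shape delivered by `RGFlow.secondDiff_initial_le_of_isTunedQ`: first-order sizes
`T_i = 2μ_i/(1−κ)` with `μ_i = m₁u_i` LINEAR in the increments `u_i`, joint initial size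
`m₀₀(u₁+T₁)(u₂+T₂)`): with `c = 2m₁/(1−κ)`,
`Rest = u₁u₂ · max (m₀₀(1+c)²) (max ((σ₂c² + 2l₀'c² + l₀₀c²ε)/η) (α(2b₀c² + b₀₀c²ε) + (η+β)(2a₀c² + a₀₀c²ε) + 2a₀b₀c²ε))`
— so the mixed second differences of [ABKM19] Theorem 2.2 are `O(u₁u₂)` with an explicit constant.
[cite: AdamsBuchholzKoteckyMuller2019, Lemma 12.6 (12.51)–(12.56), Theorem 2.2] -/
theorem secondPertSize_fixedPoint_bilinear {α β η ε σ₂ a₀ b₀ l₀' a₀₀ b₀₀ l₀₀ m₀₀ κ m₁ u₁ u₂ : ℝ}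
    (hu₁ : 0 ≤ u₁) (hu₂ : 0 ≤ u₂) :
    secondPertSize α β η ε σ₂ (a₀ * (2 * (m₁ * u₁) / (1 - κ))) (a₀ * (2 * (m₁ * u₂) / (1 - κ)))
        (a₀₀ * (2 * (m₁ * u₁) / (1 - κ)) * (2 * (m₁ * u₂) / (1 - κ)))
        (b₀ * (2 * (m₁ * u₁) / (1 - κ))) (b₀ * (2 * (m₁ * u₂) / (1 - κ)))
        (b₀₀ * (2 * (m₁ * u₁) / (1 - κ)) * (2 * (m₁ * u₂) / (1 - κ)))
        (l₀' * (2 * (m₁ * u₁) / (1 - κ))) (l₀' * (2 * (m₁ * u₂) / (1 - κ)))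
        (l₀₀ * (2 * (m₁ * u₁) / (1 - κ)) * (2 * (m₁ * u₂) / (1 - κ)))
        (m₀₀ * (u₁ + 2 * (m₁ * u₁) / (1 - κ)) * (u₂ + 2 * (m₁ * u₂) / (1 - κ)))
        (2 * (m₁ * u₁) / (1 - κ)) (2 * (m₁ * u₂) / (1 - κ))
      = u₁ * u₂ * max (m₀₀ * (1 + 2 * m₁ / (1 - κ)) ^ 2)
          (max ((σ₂ * (2 * m₁ / (1 - κ)) * (2 * m₁ / (1 - κ))
              + l₀' * (2 * m₁ / (1 - κ)) * ((2 * m₁ / (1 - κ)) + (2 * m₁ / (1 - κ)))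
              + l₀₀ * (2 * m₁ / (1 - κ)) * (2 * m₁ / (1 - κ)) * ε) / η)
            (α * (b₀ * (2 * m₁ / (1 - κ)) * ((2 * m₁ / (1 - κ)) + (2 * m₁ / (1 - κ)))
                + b₀₀ * (2 * m₁ / (1 - κ)) * (2 * m₁ / (1 - κ)) * ε)
              + (η + β) * (a₀ * (2 * m₁ / (1 - κ)) * ((2 * m₁ / (1 - κ)) + (2 * m₁ / (1 - κ)))
                + a₀₀ * (2 * m₁ / (1 - κ)) * (2 * m₁ / (1 - κ)) * ε)
              + 2 * (a₀ * (2 * m₁ / (1 - κ))) * (b₀ * (2 * m₁ / (1 - κ))) * ε)) := by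
  have h := secondPertSize_bilinear (α := α) (β := β) (η := η) (ε := ε) (σ₂ := σ₂)
    (a₀ := a₀ * (2 * m₁ / (1 - κ))) (b₀ := b₀ * (2 * m₁ / (1 - κ))) (l₀' := l₀' * (2 * m₁ / (1 - κ)))
    (a₀₀ := a₀₀ * (2 * m₁ / (1 - κ)) * (2 * m₁ / (1 - κ))) (b₀₀ := b₀₀ * (2 * m₁ / (1 - κ)) * (2 * m₁ / (1 - κ)))
    (l₀₀ := l₀₀ * (2 * m₁ / (1 - κ)) * (2 * m₁ / (1 - κ))) (m₀₀ := m₀₀ * (1 + 2 * m₁ / (1 - κ)) ^ 2)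
    (K₁ := 2 * m₁ / (1 - κ)) (K₂ := 2 * m₁ / (1 - κ)) hu₁ hu₂
  have e1 : a₀ * (2 * (m₁ * u₁) / (1 - κ)) = a₀ * (2 * m₁ / (1 - κ)) * u₁ := by ring
  have e2 : a₀ * (2 * (m₁ * u₂) / (1 - κ)) = a₀ * (2 * m₁ / (1 - κ)) * u₂ := by ring
  have e3 : a₀₀ * (2 * (m₁ * u₁) / (1 - κ)) * (2 * (m₁ * u₂) / (1 - κ))
      = a₀₀ * (2 * m₁ / (1 - κ)) * (2 * m₁ / (1 - κ)) * u₁ * u₂ := by ring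
  have e4 : b₀ * (2 * (m₁ * u₁) / (1 - κ)) = b₀ * (2 * m₁ / (1 - κ)) * u₁ := by ring
  have e5 : b₀ * (2 * (m₁ * u₂) / (1 - κ)) = b₀ * (2 * m₁ / (1 - κ)) * u₂ := by ring
  have e6 : b₀₀ * (2 * (m₁ * u₁) / (1 - κ)) * (2 * (m₁ * u₂) / (1 - κ))
      = b₀₀ * (2 * m₁ / (1 - κ)) * (2 * m₁ / (1 - κ)) * u₁ * u₂ := by ring
  have e7 : l₀' * (2 * (m₁ * u₁) / (1 - κ)) = l₀' * (2 * m₁ / (1 - κ)) * u₁ := by ring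
  have e8 : l₀' * (2 * (m₁ * u₂) / (1 - κ)) = l₀' * (2 * m₁ / (1 - κ)) * u₂ := by ring
  have e9 : l₀₀ * (2 * (m₁ * u₁) / (1 - κ)) * (2 * (m₁ * u₂) / (1 - κ))
      = l₀₀ * (2 * m₁ / (1 - κ)) * (2 * m₁ / (1 - κ)) * u₁ * u₂ := by ring
  have e10 : m₀₀ * (u₁ + 2 * (m₁ * u₁) / (1 - κ)) * (u₂ + 2 * (m₁ * u₂) / (1 - κ))
      = m₀₀ * (1 + 2 * m₁ / (1 - κ)) ^ 2 * u₁ * u₂ := by ring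
  have e11 : 2 * (m₁ * u₁) / (1 - κ) = 2 * m₁ / (1 - κ) * u₁ := by ring
  have e12 : 2 * (m₁ * u₂) / (1 - κ) = 2 * m₁ / (1 - κ) * u₂ := by ring
  rw [e1, e2, e3, e4, e5, e6, e7, e8, e9, e10, e11, e12]
  exact h

end RGFlow

end Literature.Dynamics.Hyperbolic

end
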